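import Mathlib.Analysis.Calculus.Deriv.ZPow
import Mathlib.Analysis.Calculus.Deriv.Mul
import Literature.NumberTheory.Transcendental.KZSemialgebraicComplex
import Literature.NumberTheory.Transcendental.SemialgebraicLineDeriv
import Literature.NumberTheory.Transcendental.SemialgebraicAlgebraicPoints
import Summits.KontsevichZagierPeriods.KontsevichZagierPeriods.Theorems.UnfoldedStokesStokesGenerationFibrewiseRungTransport
import Summits.KontsevichZagierPeriods.KontsevichZagierPeriods.Theorems.LiouvilleUnfoldingLogPrimitiveNLStubCellwiseFoldAux

/-!
# `StokesGeneration` (stmt-KontsevichZagierPeriods-3586) — line `fibrewise_stokes`, stub `stub_saDlogProd`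

Registered stub X1 (rung 10, the semialgebraic Baker layer) of the line `fibrewise_stokes` of the
crux `StokesGeneration` (route UnfoldedStokes): **the normalised product attached to an integer
multiplicative relation between endpoint ratios of positive semialgebraic `C¹` functions.** For
real functions `fᵢ` on `[0,1]`, `ℚ`-semialgebraic (read on the interval coordinate), positive and
continuous on `[0,1]`, differentiable on `(0,1)` with derivative `fᵢ′` (continuous on `[0,1]` and
`ℚ`-semialgebraic), and `M ∈ ℤ^s` with `Πᵢ (fᵢ(1)/fᵢ(0))^{Mᵢ} = 1`, the function
`P(u) = Πᵢ (fᵢ(u)/fᵢ(0))^{Mᵢ}` satisfies: `P > 0` on `[0,1]`, `P(0) = 1`, `P(1) = 1` (the relation),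
`P′ = P · Σᵢ Mᵢ fᵢ′/fᵢ` is the derivative of `P` on `(0,1)` (product rule `HasDerivAt.fun_finsetProd`
and `d/du (g(u)/c)^M = (g(u)/c)^M · M g′(u)/g(u)`), `P, P′` are continuous on `[0,1]`,
`P′/P = Σᵢ Mᵢ fᵢ′/fᵢ` on `[0,1]`, and `x ↦ P (x 0)`, `x ↦ P′ (x 0)` are `ℚ`-semialgebraic on the
closed square `[0,1]²` (finite products / sums / integer powers / quotients of semialgebraic
functions, Bochnak–Coste–Roy Prop. 2.2.6, the integer-power rule being the landed
`LogPrimitiveNL.fold_fun_zpow`; the constants `fᵢ(0)` are real-algebraic as values of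
`ℚ`-semialgebraic functions at the rational point `0`, hence `ℚ`-semialgebraic constants,
Kontsevich–Zagier §1.1). Transposes the landed polynomial version `stub_rungDlogProd` (rung 2).

References: J. Bochnak, M. Coste, M.-F. Roy, *Real Algebraic Geometry* (1998), Prop. 2.2.6;
M. Kontsevich, D. Zagier, *Periods* (2001), §1.1.
-/

noncomputable section

-- `Summit.KontsevichZagierPeriods.KontsevichZagierPeriods.…` is the tree's mandated layout (single-conjunct summit).
set_option linter.dupNamespace false

namespace Summit.KontsevichZagierPeriods.KontsevichZagierPeriods.Cruxes.StokesGeneration.FibrewiseStokes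

open MeasureTheory Set
open Literature.NumberTheory.Transcendental
open Literature.NumberTheory.Transcendental.KZ
open Literature.ModelTheory.ExponentialFields (IsSemialgebraic)
open Summit.KontsevichZagierPeriods.LiouvilleUnfolding.LogPrimitiveNL (fold_fun_zpow)

/-! ## The factors `f(u)/f(0)` -/

/-- The derivative of one factor: `d/du (g(u)/c)^M = (g(u)/c)^M · (M · g′(u)/g(u))` at a point
where `g` is differentiable and `g(u) ≠ 0` (`c ≠ 0`). [folklore] -/
theorem hasDerivAt_sa_divConstZPow {g : ℝ → ℝ} {g' c u : ℝ} (hc : c ≠ 0) (M : ℤ)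
    (hg : HasDerivAt g g' u) (hgu : g u ≠ 0) :
    HasDerivAt (fun v => (g v / c) ^ M) ((g u / c) ^ M * ((M : ℝ) * (g' / g u))) u := by
  have hqc : g u / c ≠ 0 := div_ne_zero hgu hc
  have hd : HasDerivAt (fun v => g v / c) (g' / c) u := hg.div_const c
  have hz : HasDerivAt (fun v => (g v / c) ^ M) ((M : ℝ) * (g u / c) ^ (M - 1) * (g' / c)) u := by
    have := (hasDerivAt_zpow M (g u / c) (Or.inl hqc)).comp u hd
    exact this
  refine hz.congr_deriv ?_
  rw [zpow_sub_one₀ hqc]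
  generalize (g u / c) ^ M = w
  field_simp

/-- The value at `0` of a function `ℚ`-semialgebraic on the unit interval (read on the interval
coordinate) is a real-algebraic number. [folklore] -/
theorem isAlgebraic_sa_apply_zero {g : ℝ → ℝ}
    (hg : IsSemialgebraicFunOn ℚ (Set.pi Set.univ (fun _ : Fin 1 => Set.Icc (0:ℝ) 1)) (fun z => g (z 0))) :
    IsAlgebraic ℚ (g 0) :=
  hg.isAlgebraic_apply (a := fun _ => (0:ℝ)) (fun _ _ => ⟨le_rfl, zero_le_one⟩)
    fun _ => isAlgebraic_zero

/-! ## The stub -/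

/-- STUB (rung 10, X1) **the normalised product of positive semialgebraic `C¹` functions attached
to a multiplicative relation between their endpoint ratios**: `P = Πᵢ (fᵢ/fᵢ(0))^{Mᵢ}` is positive,
`P(0) = P(1) = 1`, `C¹` on `(0,1)` with `P′ = P·Σ Mᵢ fᵢ′/fᵢ`, `P, P′` continuous on `[0,1]` and
`ℚ`-semialgebraic on the square. [folklore] -/
theorem stub_saDlogProd :
    ∀ (s : ℕ) (f f' : Fin s → ℝ → ℝ) (M : Fin s → ℤ) (P P' : ℝ → ℝ),
      (∀ i, IsSemialgebraicFunOn ℚ (Set.pi Set.univ (fun _ : Fin 1 => Set.Icc (0:ℝ) 1)) (fun z => f i (z 0))) →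
      (∀ i, IsSemialgebraicFunOn ℚ (Set.pi Set.univ (fun _ : Fin 1 => Set.Icc (0:ℝ) 1)) (fun z => f' i (z 0))) →
      (∀ i, ∀ u ∈ Set.Icc (0:ℝ) 1, 0 < f i u) → (∀ i, ContinuousOn (f i) (Set.Icc (0:ℝ) 1)) →
      (∀ i, ContinuousOn (f' i) (Set.Icc (0:ℝ) 1)) → (∀ i, ∀ u ∈ Set.Ioo (0:ℝ) 1, HasDerivAt (f i) (f' i u) u) →
      ∏ i, (f i 1 / f i 0) ^ (M i) = 1 →
      (∀ u, P u = ∏ i, (f i u / f i 0) ^ (M i)) →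
      (∀ u, P' u = P u * ∑ i, (M i : ℝ) * (f' i u / f i u)) →
      IsSemialgebraicFunOn ℚ (Set.pi Set.univ (fun _ : Fin 2 => Set.Icc (0:ℝ) 1)) (fun x => P (x 0)) ∧
        IsSemialgebraicFunOn ℚ (Set.pi Set.univ (fun _ : Fin 2 => Set.Icc (0:ℝ) 1)) (fun x => P' (x 0)) ∧
        (∀ u ∈ Set.Icc (0:ℝ) 1, 0 < P u) ∧ P 0 = 1 ∧ P 1 = 1 ∧
        ContinuousOn P (Set.Icc (0:ℝ) 1) ∧ ContinuousOn P' (Set.Icc (0:ℝ) 1) ∧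
        (∀ u ∈ Set.Ioo (0:ℝ) 1, HasDerivAt P (P' u) u) ∧
        ∀ u ∈ Set.Icc (0:ℝ) 1, P' u / P u = ∑ i, (M i : ℝ) * (f' i u / f i u) := by
  intro s f f' M P P' hsa hsa' hpos hfc hf'c hder hrel hP hP'
  have h0mem : (0:ℝ) ∈ Set.Icc (0:ℝ) 1 := ⟨le_rfl, zero_le_one⟩
  have hf0 : ∀ i, 0 < f i 0 := fun i => hpos i 0 h0mem
  -- positivity of the factor bases and of `P` on `[0,1]`
  have hbase : ∀ i, ∀ u ∈ Set.Icc (0:ℝ) 1, 0 < f i u / f i 0 := fun i u hu =>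
    div_pos (hpos i u hu) (hf0 i)
  have hPpos : ∀ u ∈ Set.Icc (0:ℝ) 1, 0 < P u := fun u hu => by
    rw [hP u]
    exact Finset.prod_pos fun i _ => zpow_pos (hbase i u hu) _
  -- the derivative of `P` at every point of `(0,1)`
  have hPfun : P = fun v => ∏ i, (f i v / f i 0) ^ (M i) := funext hP
  have hderiv : ∀ u ∈ Set.Ioo (0:ℝ) 1, HasDerivAt P (P' u) u := by
    intro u hu
    have hu' : u ∈ Set.Icc (0:ℝ) 1 := Set.Ioo_subset_Icc_self hu
    have hfac : ∀ i ∈ (Finset.univ : Finset (Fin s)),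
        HasDerivAt (fun v => (f i v / f i 0) ^ (M i))
          ((f i u / f i 0) ^ (M i) * ((M i : ℝ) * (f' i u / f i u))) u := fun i _ =>
      hasDerivAt_sa_divConstZPow (hf0 i).ne' (M i) (hder i u hu) (hpos i u hu').ne'
    have key : HasDerivAt (fun v => ∏ i, (f i v / f i 0) ^ (M i))
        ((∏ i, (f i u / f i 0) ^ (M i)) * ∑ i, (M i : ℝ) * (f' i u / f i u)) u := by
      refine (HasDerivAt.fun_finsetProd hfac).congr_deriv ?_
      rw [Finset.mul_sum]
      refine Finset.sum_congr rfl fun i _ => ?_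
      rw [smul_eq_mul, ← mul_assoc, Finset.prod_erase_mul _ _ (Finset.mem_univ i)]
    rw [hP' u, hP u, hPfun]
    exact key
  -- continuity on the closed interval
  have hPcont : ContinuousOn P (Set.Icc (0:ℝ) 1) := by
    rw [hPfun]
    exact continuousOn_finsetProd _ fun i _ =>
      ((hfc i).div_const (f i 0)).zpow₀ (M i) fun u hu => Or.inl (hbase i u hu).ne'
  have hP'cont : ContinuousOn P' (Set.Icc (0:ℝ) 1) := by
    have hP'fun : P' = fun u => P u * ∑ i, (M i : ℝ) * (f' i u / f i u) := funext hP'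
    rw [hP'fun]
    exact hPcont.mul (continuousOn_finsetSum _ fun i _ =>
      continuousOn_const.mul ((hf'c i).div (hfc i) fun u hu => (hpos i u hu).ne'))
  -- semialgebraicity on the square
  have hS : IsSemialgebraic ℚ (Set.pi Set.univ (fun _ : Fin 2 => Set.Icc (0:ℝ) 1)) := by
    rw [← cube_eq_pi]
    exact isSemialgebraic_cube
  have hx0 : ∀ x ∈ Set.pi Set.univ (fun _ : Fin 2 => Set.Icc (0:ℝ) 1), x 0 ∈ Set.Icc (0:ℝ) 1 :=
    fun x hx => hx 0 (Set.mem_univ _)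
  have halg0 : ∀ i, IsAlgebraic ℚ (f i 0) := fun i => isAlgebraic_sa_apply_zero (hsa i)
  have hfS : ∀ i, IsSemialgebraicFunOn ℚ (Set.pi Set.univ (fun _ : Fin 2 => Set.Icc (0:ℝ) 1))
      (fun x => f i (x 0)) := fun i => isSemialgebraicFunOn_sq_of_interval (hsa i)
  have hf'S : ∀ i, IsSemialgebraicFunOn ℚ (Set.pi Set.univ (fun _ : Fin 2 => Set.Icc (0:ℝ) 1))
      (fun x => f' i (x 0)) := fun i => isSemialgebraicFunOn_sq_of_interval (hsa' i)
  have hPS : IsSemialgebraicFunOn ℚ (Set.pi Set.univ (fun _ : Fin 2 => Set.Icc (0:ℝ) 1))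
      (fun x => ∏ i, (f i (x 0) / f i 0) ^ (M i)) :=
    IsSemialgebraicFunOn.fun_finsetProd Finset.univ hS fun i _ =>
      fold_fun_zpow ((hfS i).div (isSemialgebraicFunOn_const_of_isAlgebraic hS (halg0 i))
        fun _ _ => (hf0 i).ne') (M i)
  have hsumS : IsSemialgebraicFunOn ℚ (Set.pi Set.univ (fun _ : Fin 2 => Set.Icc (0:ℝ) 1))
      (fun x => ∑ i, (M i : ℝ) * (f' i (x 0) / f i (x 0))) :=
    IsSemialgebraicFunOn.fun_finsetSum Finset.univ hS fun i _ =>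
      (isSemialgebraicFunOn_const_intCast hS (M i)).fun_mul
        (((hf'S i).div (hfS i)) fun x hx => (hpos i _ (hx0 x hx)).ne')
  refine ⟨hPS.congr fun x _ => (hP (x 0)).symm,
    (hPS.fun_mul hsumS).congr fun x _ => by rw [hP' (x 0), hP (x 0)],
    hPpos, ?_, ?_, hPcont, hP'cont, hderiv,
    fun u hu => by rw [hP' u, mul_div_cancel_left₀ _ (hPpos u hu).ne']⟩
  · rw [hP 0]
    exact Finset.prod_eq_one fun i _ => by rw [div_self (hf0 i).ne', one_zpow]
  · rw [hP 1]
    exact hrel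

end Summit.KontsevichZagierPeriods.KontsevichZagierPeriods.Cruxes.StokesGeneration.FibrewiseStokes
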